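import Literature.NumberTheory.Rogawski1990.EndoscopicScalarPairClasses
import Literature.NumberTheory.Rogawski1990.TransferringClassesSemisimple
import HarnessLib

/-!
# The anchored stable `SJ_H` datum of the engine line: the `SJ_H` TRICHOTOMY [Rogawski1990, Thm. 14.5.1 (a), Lemma 14.5.2, Prop. 10.1.2 (a)]

Kit-free VALUE FUNCTIONS behind the stable endoscopic terms `SJ_H(𝒪′_st, f^H)` of Rogawski's stabilised trace formula for the inner form `G′ = U(H)`,
`H` anisotropic, over the CM extension `L/L⁺` (engine line `F0_T1InnerFormTraceIdentity`, O7 anchor surgery, RULING #118 «leaves first»), and the BODIES of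
the line's `SJ_H` pins over unfolded binders:
* §1 **`scalarPairCoeff H α Cs 𝒪H`** = `m_H(𝒪H)`: at a scalar-pair class `[(ζ•1₂, u•1₁)]` (★ `IsScalarPairClass`) transferring to `𝒪 ⊂ G′(L⁺)`, `α(𝒪) · Cs (out 𝒪) ζ u γH♮`
  (`α` the mass datum of the line, `Cs` the positive κ-mass constant of ★ `SingularEllipticTransfer` (κ-MASS)); **`sjHTrichotomy H α Cs r`** = `m_H · f^H(γH♮ ⊗ 1)`
  at the scalar-pair classes [Lemma 14.5.2 (b): `½ SJ(𝒪′_st, f′^H) = ½ m(Z_H H∖H) Φ^κ(γ′, f′)`], the caller's regular datum `r` elsewhere; pin bodies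
  `sjHTrichotomy_eq_of_transfersTo` ((xiii″-s)(i)), `kappaMass_of_spec_out` ((xiii″-s)(ii) modulo a `Cs`-spec), `finite_support_sjHTrichotomy` (xiii-f),
  `sjHTrichotomy_eq_zero_of_not_isSemisimple` (xiii-0), `sjHTrichotomy_eq_zero_of_charpoly_fst_eq` (c-s), `exists_sjHTrichotomy_eq_mul_of_fst_eq_smul_one` (xiii‴-cc).
* §2 **`regularSJH κH m₂`** — the `G`-REGULAR datum `κ_H(𝒪H) · Φ^{st,𝐀}_H(out 𝒪H; m₂; f^H)` [Thm. 14.5.1 (a), (5.4.3)], `0` off the `G`-regular classes — and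
  **`anchoredSJH H α Cs κH m₂ := sjHTrichotomy H α Cs (regularSJH κH m₂)`**, THE anchored `SJ_H` of ED 1.24, with the six pin bodies specialised
  (`anchoredSJH_eq_of_isGRegular` (xiii″) via ★ `adelicStableOrbitalIntegralH_out_eq`, `finite_support_anchoredSJH` (xiii-f), …, `anchoredSJH_eq_of_transfersTo`).

## References
* J. D. Rogawski, *Automorphic Representations of Unitary Groups in Three Variables*, Ann. of Math. Stud. 123 (1990), §5.4 (5.4.3) and Prop. 5.4.1
  pp. 72–77, Prop. 10.1.2 (a) p. 146, §14.1 p. 232, Thm. 14.5.1 (a) and Lemma 14.5.2 (a)(b)(c) pp. 237–240 [Rogawski1990].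
-/

set_option autoImplicit false

noncomputable section

open NumberField IsDedekindDomain Polynomial
open scoped MatrixGroups

namespace Literature.NumberTheory.Rogawski1990

open Literature.NumberTheory.Automorphic
open Literature.AlgebraicGeometry.ShimuraVarieties (hermForm)

section General

variable {L : Type} [Field L] [NumberField L] [IsCMField L]

/-- `(X − a)² ∣ p ⇒ p` is not separable. [folklore] -/
private theorem not_separable_of_X_sub_C_sq_dvd' {K : Type*} [Field K] {p : Polynomial K} {a : K} (h : (Polynomial.X - Polynomial.C a) ^ 2 ∣ p) :
    ¬ p.Separable := fun hs =>
  Polynomial.not_isUnit_X_sub_C a (hs.squarefree _ (by simpa [sq] using h))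

omit [NumberField L] [IsCMField L] in
/-- A `1 × 1` matrix is the scalar `M₀₀ • 1`. [folklore] -/
private theorem matrix_fin_one_eq_smul_one' (M : Matrix (Fin 1) (Fin 1) L) : M = M 0 0 • (1 : Matrix (Fin 1) (Fin 1) L) := by
  ext i j; fin_cases i; fin_cases j; simp

/-- A class `𝒪′_st(γH)` with `charpoly ι(γH) = charpoly γH.1 · (X − (γH.2)₀₀)` NOT separable is not `G`-regular (★ `charpoly_endoEmb`). [folklore] -/
private theorem not_isGRegular_stableClassHOf_of_not_separable'
    (γH : (UnitaryGroup.cmDatum L 2 (Matrix.of fun i j : Fin 2 => if i.val + j.val + 1 = 2 then (1 : L) else 0)).Rational ×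
      (UnitaryGroup.cmDatum L 1 (Matrix.of fun i j : Fin 1 => if i.val + j.val + 1 = 1 then (1 : L) else 0)).Rational)
    (h : ¬ ((((γH.1.val : GL (Fin 2) L) : Matrix (Fin 2) (Fin 2) L).charpoly) *
      (Polynomial.X - Polynomial.C (((γH.2.val : GL (Fin 1) L) : Matrix (Fin 1) (Fin 1) L) 0 0))).Separable) :
    ¬ (stableClassHOf (cmConjRingHom L) (Matrix.of fun i j : Fin 2 => if i.val + j.val + 1 = 2 then (1 : L) else 0)
        (Matrix.of fun i j : Fin 1 => if i.val + j.val + 1 = 1 then (1 : L) else 0) γH).IsGRegular endoForm_antidiagOne := by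
  intro hreg
  rw [StableClassH.isGRegular_stableClassHOf] at hreg
  unfold IsGRegular IsRegularElt at hreg
  rw [charpoly_endoEmb] at hreg
  exact h hreg

end General

/-! ## §1 The kit-free `SJ_H` value functions of the trichotomy and the pin bodies [Rogawski1990, Lemma 14.5.2 (b), Prop. 10.1.2 (a)] -/

section Trichotomy

variable {L : Type} [Field L] [NumberField L] [IsCMField L] (H : Matrix (Fin 3) (Fin 3) L)
  (α : StableClass (cmConjRingHom L) H → ℝ)
  (Cs : (UnitaryGroup.cmDatum L 3 H).Rational → L → L → (UnitaryGroup.cmDatum L 2 (Matrix.of fun i j : Fin 2 => if i.val + j.val + 1 = 2 then (1 : L) else 0)).Rational × (UnitaryGroup.cmDatum L 1 (Matrix.of fun i j : Fin 1 => if i.val + j.val + 1 = 1 then (1 : L) else 0)).Rational → ℝ)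
  (r : StableClassH (cmConjRingHom L) (Matrix.of fun i j : Fin 2 => if i.val + j.val + 1 = 2 then (1 : L) else 0) (Matrix.of fun i j : Fin 1 => if i.val + j.val + 1 = 1 then (1 : L) else 0) → CompactlySupportedContinuousMap ((UnitaryGroup.cmDatum L 2 (Matrix.of fun i j : Fin 2 => if i.val + j.val + 1 = 2 then (1 : L) else 0)).Adelic × (UnitaryGroup.cmDatum L 1 (Matrix.of fun i j : Fin 1 => if i.val + j.val + 1 = 1 then (1 : L) else 0)).Adelic) ℂ → ℂ)

open scoped Classical in
/-- **THE SINGULAR `SJ_H` COEFFICIENT `m_H(𝒪H)`**: at a scalar-pair class `𝒪H = [(ζ•1₂, u•1₁)]` transferring to `𝒪` (split-singular non-central in `U(H)`),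
`α(𝒪) · Cs (out 𝒪) ζ u γH♮` (mass datum `α`, κ-mass constant `Cs` read at the chosen representative `out 𝒪`); `0` otherwise. HONEST PRINT: `m_H = m(Z_H H_F∖H_𝐀)`
for Tamagawa-compatible measures. [cite: Rogawski1990, Prop. 10.1.2 (a) p. 146; Lemma 14.5.2 (b) p. 238] -/
def scalarPairCoeff (𝒪H : StableClassH (cmConjRingHom L) (Matrix.of fun i j : Fin 2 => if i.val + j.val + 1 = 2 then (1 : L) else 0) (Matrix.of fun i j : Fin 1 => if i.val + j.val + 1 = 1 then (1 : L) else 0)) : ℂ :=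
  if hT : ∃ 𝒪 : StableClass (cmConjRingHom L) H, 𝒪H.TransfersTo H endoForm_antidiagOne 𝒪 then
    if h : IsScalarPairClass 𝒪H then
      ((α hT.choose * Cs (Quotient.out (s := stableConjSetoid _ _) hT.choose) h.fstScalar h.sndScalar h.rep : ℝ) : ℂ)
    else 0
  else 0

open scoped Classical in
/-- **THE `SJ_H` TRICHOTOMY** (O7): at a scalar-pair class `𝒪H = [(ζ•1₂, u•1₁)]`, `ζ ≠ u`, `SJ_H(𝒪H, f^H) := m_H(𝒪H) · f^H(γH♮ ⊗ 1)` at the CANONICAL scalar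
representative (representative-free, `IsScalarPairClass.rep_eq`); at every other class (the central-IMAGE class `[(ζ•1₂, ζ•1₁)]` included) the caller's
REGULAR-branch datum `r 𝒪H f^H`. [cite: Rogawski1990, Thm. 14.5.1 (a) p. 238; Lemma 14.5.2 (b) p. 238; Prop. 10.1.2 (a) p. 146] -/
def sjHTrichotomy (𝒪H : StableClassH (cmConjRingHom L) (Matrix.of fun i j : Fin 2 => if i.val + j.val + 1 = 2 then (1 : L) else 0) (Matrix.of fun i j : Fin 1 => if i.val + j.val + 1 = 1 then (1 : L) else 0)) (fH : CompactlySupportedContinuousMap ((UnitaryGroup.cmDatum L 2 (Matrix.of fun i j : Fin 2 => if i.val + j.val + 1 = 2 then (1 : L) else 0)).Adelic × (UnitaryGroup.cmDatum L 1 (Matrix.of fun i j : Fin 1 => if i.val + j.val + 1 = 1 then (1 : L) else 0)).Adelic) ℂ) : ℂ :=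
  if h : IsScalarPairClass 𝒪H then
    scalarPairCoeff H α Cs 𝒪H * fH (((UnitaryGroup.cmDatum L 2 (Matrix.of fun i j : Fin 2 => if i.val + j.val + 1 = 2 then (1 : L) else 0)).toAdelic h.rep.1, (UnitaryGroup.cmDatum L 1 (Matrix.of fun i j : Fin 1 => if i.val + j.val + 1 = 1 then (1 : L) else 0)).toAdelic h.rep.2))
  else r 𝒪H fH

variable {H α Cs r}

/-- Off the scalar-pair classes the trichotomy IS the regular-branch datum. [cite: Rogawski1990, Thm. 14.5.1 (a) p. 238] -/
theorem sjHTrichotomy_of_not {𝒪H : StableClassH (cmConjRingHom L) (Matrix.of fun i j : Fin 2 => if i.val + j.val + 1 = 2 then (1 : L) else 0) (Matrix.of fun i j : Fin 1 => if i.val + j.val + 1 = 1 then (1 : L) else 0)} (h : ¬ IsScalarPairClass 𝒪H) (fH : CompactlySupportedContinuousMap ((UnitaryGroup.cmDatum L 2 (Matrix.of fun i j : Fin 2 => if i.val + j.val + 1 = 2 then (1 : L) else 0)).Adelic × (UnitaryGroup.cmDatum L 1 (Matrix.of fun i j : Fin 1 => if i.val + j.val + 1 = 1 then (1 : L) else 0)).Adelic)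 ℂ) :
    sjHTrichotomy H α Cs r 𝒪H fH = r 𝒪H fH := by
  unfold sjHTrichotomy; rw [dif_neg h]

/-- At a scalar-pair class the trichotomy is `m_H · f^H(γH♮ ⊗ 1)`. [cite: Rogawski1990, Lemma 14.5.2 (b) p. 238] -/
theorem sjHTrichotomy_of {𝒪H : StableClassH (cmConjRingHom L) (Matrix.of fun i j : Fin 2 => if i.val + j.val + 1 = 2 then (1 : L) else 0) (Matrix.of fun i j : Fin 1 => if i.val + j.val + 1 = 1 then (1 : L) else 0)} (h : IsScalarPairClass 𝒪H) (fH : CompactlySupportedContinuousMap ((UnitaryGroup.cmDatum L 2 (Matrix.of fun i j : Fin 2 => if i.val + j.val + 1 = 2 then (1 : L) else 0)).Adelic × (UnitaryGroup.cmDatum L 1 (Matrix.of fun i j : Fin 1 => if i.val + j.val + 1 = 1 then (1 : L) else 0)).Adelic) ℂ) :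
    sjHTrichotomy H α Cs r 𝒪H fH = scalarPairCoeff H α Cs 𝒪H * fH (((UnitaryGroup.cmDatum L 2 (Matrix.of fun i j : Fin 2 => if i.val + j.val + 1 = 2 then (1 : L) else 0)).toAdelic h.rep.1, (UnitaryGroup.cmDatum L 1 (Matrix.of fun i j : Fin 1 => if i.val + j.val + 1 = 1 then (1 : L) else 0)).toAdelic h.rep.2)) := by
  unfold sjHTrichotomy; rw [dif_pos h]

/-- **The singular value, representative-free**: at `𝒪H = 𝒪′_st(γH)` with `γH = (a•1₂, b•1₁)`, `a ≠ b`, `SJ_H(𝒪H, f^H) = m_H(𝒪H) · f^H(γH ⊗ 1)` for THIS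
`γH` (`IsScalarPairClass.rep_eq`). [cite: Rogawski1990, Lemma 14.5.2 (b) p. 238; Prop. 10.1.2 (a) p. 146] -/
theorem sjHTrichotomy_eq_coeff_mul {𝒪H : StableClassH (cmConjRingHom L) (Matrix.of fun i j : Fin 2 => if i.val + j.val + 1 = 2 then (1 : L) else 0) (Matrix.of fun i j : Fin 1 => if i.val + j.val + 1 = 1 then (1 : L) else 0)} {γH : (UnitaryGroup.cmDatum L 2 (Matrix.of fun i j : Fin 2 => if i.val + j.val + 1 = 2 then (1 : L) else 0)).Rational × (UnitaryGroup.cmDatum L 1 (Matrix.of fun i j : Fin 1 => if i.val + j.val + 1 = 1 then (1 : L) else 0)).Rational} {a b : L}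
    (he : 𝒪H = stableClassHOf (cmConjRingHom L) (Matrix.of fun i j : Fin 2 => if i.val + j.val + 1 = 2 then (1 : L) else 0) (Matrix.of fun i j : Fin 1 => if i.val + j.val + 1 = 1 then (1 : L) else 0) γH) (hab : a ≠ b)
    (h1 : ((γH.1.val : GL (Fin 2) L) : Matrix (Fin 2) (Fin 2) L) = a • (1 : Matrix (Fin 2) (Fin 2) L))
    (h2 : ((γH.2.val : GL (Fin 1) L) : Matrix (Fin 1) (Fin 1) L) = b • (1 : Matrix (Fin 1) (Fin 1) L))
    (fH : CompactlySupportedContinuousMap ((UnitaryGroup.cmDatum L 2 (Matrix.of fun i j : Fin 2 => if i.val + j.val + 1 = 2 then (1 : L) else 0)).Adelic × (UnitaryGroup.cmDatum L 1 (Matrix.of fun i j : Fin 1 => if i.val + j.val + 1 = 1 then (1 : L) else 0)).Adelic) ℂ) :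
    sjHTrichotomy H α Cs r 𝒪H fH = scalarPairCoeff H α Cs 𝒪H * fH (((UnitaryGroup.cmDatum L 2 (Matrix.of fun i j : Fin 2 => if i.val + j.val + 1 = 2 then (1 : L) else 0)).toAdelic γH.1, (UnitaryGroup.cmDatum L 1 (Matrix.of fun i j : Fin 1 => if i.val + j.val + 1 = 1 then (1 : L) else 0)).toAdelic γH.2)) := by
  have h : IsScalarPairClass 𝒪H := ⟨γH, a, b, hab, he, h1, h2⟩
  rw [sjHTrichotomy_of h, (h.rep_eq he h1 h2).1]

/-- **The singular coefficient at a transferring scalar-pair class**: `m_H(𝒪′_st(a•1₂, b•1₁)) = α(𝒪) · Cs (out 𝒪) a b γH` when the class transfers to `𝒪`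
(★ `StableClassH.TransfersTo.right_unique`, `IsScalarPairClass.rep_eq`). [cite: Rogawski1990, Prop. 10.1.2 (a) p. 146; §14.1 p. 232] -/
theorem scalarPairCoeff_eq_of_transfersTo {𝒪H : StableClassH (cmConjRingHom L) (Matrix.of fun i j : Fin 2 => if i.val + j.val + 1 = 2 then (1 : L) else 0) (Matrix.of fun i j : Fin 1 => if i.val + j.val + 1 = 1 then (1 : L) else 0)} {𝒪 : StableClass (cmConjRingHom L) H} {γH : (UnitaryGroup.cmDatum L 2 (Matrix.of fun i j : Fin 2 => if i.val + j.val + 1 = 2 then (1 : L) else 0)).Rational × (UnitaryGroup.cmDatum L 1 (Matrix.of fun i j : Fin 1 => if i.val + j.val + 1 = 1 then (1 : L) else 0)).Rational} {a b : L}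
    (he : 𝒪H = stableClassHOf (cmConjRingHom L) (Matrix.of fun i j : Fin 2 => if i.val + j.val + 1 = 2 then (1 : L) else 0) (Matrix.of fun i j : Fin 1 => if i.val + j.val + 1 = 1 then (1 : L) else 0) γH) (hab : a ≠ b)
    (h1 : ((γH.1.val : GL (Fin 2) L) : Matrix (Fin 2) (Fin 2) L) = a • (1 : Matrix (Fin 2) (Fin 2) L))
    (h2 : ((γH.2.val : GL (Fin 1) L) : Matrix (Fin 1) (Fin 1) L) = b • (1 : Matrix (Fin 1) (Fin 1) L))
    (hT : 𝒪H.TransfersTo H endoForm_antidiagOne 𝒪) :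
    scalarPairCoeff H α Cs 𝒪H = ((α 𝒪 * Cs (Quotient.out (s := stableConjSetoid _ _) 𝒪) a b γH : ℝ) : ℂ) := by
  classical
  have h : IsScalarPairClass 𝒪H := ⟨γH, a, b, hab, he, h1, h2⟩
  have hex : ∃ 𝒪' : StableClass (cmConjRingHom L) H, 𝒪H.TransfersTo H endoForm_antidiagOne 𝒪' := ⟨𝒪, hT⟩
  have hc : hex.choose = 𝒪 := StableClassH.TransfersTo.right_unique hex.choose_spec hT
  obtain ⟨hr, ha, hb⟩ := h.rep_eq he h1 h2
  unfold scalarPairCoeff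
  rw [dif_pos hex, dif_pos h, hc, hr, ha, hb]

/-- **[Lemma 14.5.2 (b) ∕ Prop. 10.1.2 (a)] THE `SJ_H` VALUE AT THE SINGULAR PREIMAGE** ((xiii″-s)(i) over unfolded binders): at `𝒪H = 𝒪′_st(a•1₂, b•1₁) ↦ 𝒪`,
`a ≠ b`: `SJ_H(𝒪H, f^H) = m_H · f^H(γH ⊗ 1)`, `m_H = α(𝒪) · Cs (out 𝒪) a b γH`. [cite: Rogawski1990, Prop. 10.1.2 (a) p. 146; Lemma 14.5.2 (b) p. 238] -/
theorem sjHTrichotomy_eq_of_transfersTo {𝒪H : StableClassH (cmConjRingHom L) (Matrix.of fun i j : Fin 2 => if i.val + j.val + 1 = 2 then (1 : L) else 0) (Matrix.of fun i j : Fin 1 => if i.val + j.val + 1 = 1 then (1 : L) else 0)} {𝒪 : StableClass (cmConjRingHom L) H} {γH : (UnitaryGroup.cmDatum L 2 (Matrix.of fun i j : Fin 2 => if i.val + j.val + 1 = 2 then (1 : L) else 0)).Rational × (UnitaryGroup.cmDatum L 1 (Matrix.of fun i j : Fin 1 => if i.val + j.val + 1 = 1 then (1 : L) else 0)).Rational}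 {a b : L}
    (he : 𝒪H = stableClassHOf (cmConjRingHom L) (Matrix.of fun i j : Fin 2 => if i.val + j.val + 1 = 2 then (1 : L) else 0) (Matrix.of fun i j : Fin 1 => if i.val + j.val + 1 = 1 then (1 : L) else 0) γH) (hab : a ≠ b)
    (h1 : ((γH.1.val : GL (Fin 2) L) : Matrix (Fin 2) (Fin 2) L) = a • (1 : Matrix (Fin 2) (Fin 2) L))
    (h2 : ((γH.2.val : GL (Fin 1) L) : Matrix (Fin 1) (Fin 1) L) = b • (1 : Matrix (Fin 1) (Fin 1) L))
    (hT : 𝒪H.TransfersTo H endoForm_antidiagOne 𝒪) (fH : CompactlySupportedContinuousMap ((UnitaryGroup.cmDatum L 2 (Matrix.of fun i j : Fin 2 => if i.val + j.val + 1 = 2 then (1 : L) else 0)).Adelic × (UnitaryGroup.cmDatum L 1 (Matrix.of fun i j : Fin 1 => if i.val + j.val + 1 = 1 then (1 : L) else 0)).Adelic) ℂ) :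
    sjHTrichotomy H α Cs r 𝒪H fH = ((α 𝒪 * Cs (Quotient.out (s := stableConjSetoid _ _) 𝒪) a b γH : ℝ) : ℂ) * fH (((UnitaryGroup.cmDatum L 2 (Matrix.of fun i j : Fin 2 => if i.val + j.val + 1 = 2 then (1 : L) else 0)).toAdelic γH.1, (UnitaryGroup.cmDatum L 1 (Matrix.of fun i j : Fin 1 => if i.val + j.val + 1 = 1 then (1 : L) else 0)).toAdelic γH.2)) := by
  rw [sjHTrichotomy_eq_coeff_mul he hab h1 h2, scalarPairCoeff_eq_of_transfersTo he hab h1 h2 hT]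

/-- **[Lemma 14.5.2 (b), κ-half] THE κ-MASS IDENTITY from a `Cs`-spec read at `out 𝒪`** ((xiii″-s)(ii) modulo the spec): for a STABLY INVARIANT `Φ`
(the all-classes sum `γ ↦ Σ_{𝒞′_𝐀(γ)} Φ(·)`, ★ `MatchingAdeleG₂.classes_eq_of_isStablyConj`) with `Φ(out 𝒪) = Cs (out 𝒪) a b γH · t` (hypotheses reach `out 𝒪`
by `singularHyps_of_isStablyConj`), `α(𝒪) · Φ(γ₀) = m_H · t`. [cite: Rogawski1990, Lemma 14.5.2 (b) p. 238; §5.4 (5.4.3) p. 72] -/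
theorem kappaMass_of_spec_out (α : StableClass (cmConjRingHom L) H → ℝ)
    (Cs : (UnitaryGroup.cmDatum L 3 H).Rational → L → L → (UnitaryGroup.cmDatum L 2 (Matrix.of fun i j : Fin 2 => if i.val + j.val + 1 = 2 then (1 : L) else 0)).Rational × (UnitaryGroup.cmDatum L 1 (Matrix.of fun i j : Fin 1 => if i.val + j.val + 1 = 1 then (1 : L) else 0)).Rational → ℝ)
    {𝒪 : StableClass (cmConjRingHom L) H} {γ₀ : (UnitaryGroup.cmDatum L 3 H).Rational} (he : 𝒪 = stableClassOf (cmConjRingHom L) H γ₀)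
    {Φ : (UnitaryGroup.cmDatum L 3 H).Rational → ℂ} (hΦ : ∀ γ δ : (UnitaryGroup.cmDatum L 3 H).Rational, IsStablyConj (cmConjRingHom L) H γ δ → Φ γ = Φ δ)
    {a b : L} {γH : (UnitaryGroup.cmDatum L 2 (Matrix.of fun i j : Fin 2 => if i.val + j.val + 1 = 2 then (1 : L) else 0)).Rational × (UnitaryGroup.cmDatum L 1 (Matrix.of fun i j : Fin 1 => if i.val + j.val + 1 = 1 then (1 : L) else 0)).Rational} {t : ℂ}
    (hspec : Φ (Quotient.out (s := stableConjSetoid _ _) 𝒪) = (Cs (Quotient.out (s := stableConjSetoid _ _) 𝒪) a b γH : ℂ) * t) :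
    ((α 𝒪 : ℝ) : ℂ) * Φ γ₀ = ((α 𝒪 * Cs (Quotient.out (s := stableConjSetoid _ _) 𝒪) a b γH : ℝ) : ℂ) * t := by
  have hout : IsStablyConj (cmConjRingHom L) H (Quotient.out (s := stableConjSetoid _ _) 𝒪) γ₀ :=
    stableClassOf_eq_iff.mp ((Quotient.out_eq (s := stableConjSetoid _ _) 𝒪).trans he)
  have h1 : Φ γ₀ = (Cs (Quotient.out (s := stableConjSetoid _ _) 𝒪) a b γH : ℂ) * t := (hΦ _ _ hout).symm.trans hspec
  rw [h1, Complex.ofReal_mul, mul_assoc]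

/-- **(xiii-f) body: finite support of the trichotomy** — inside the regular datum's support union the finitely many scalar-pair classes met by `f^H`
(`finite_setOf_isScalarPairClass_apply_ne_zero`). [cite: Rogawski1990, §14.5 p. 238; §5.4 pp. 72–73] -/
theorem finite_support_sjHTrichotomy (fH : CompactlySupportedContinuousMap ((UnitaryGroup.cmDatum L 2 (Matrix.of fun i j : Fin 2 => if i.val + j.val + 1 = 2 then (1 : L) else 0)).Adelic × (UnitaryGroup.cmDatum L 1 (Matrix.of fun i j : Fin 1 => if i.val + j.val + 1 = 1 then (1 : L) else 0)).Adelic) ℂ)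
    (hr : (Function.support fun 𝒪H => r 𝒪H fH).Finite) : (Function.support fun 𝒪H => sjHTrichotomy H α Cs r 𝒪H fH).Finite := by
  refine (hr.union (finite_setOf_isScalarPairClass_apply_ne_zero fH)).subset fun 𝒪H h𝒪 => ?_
  have hne : sjHTrichotomy H α Cs r 𝒪H fH ≠ 0 := h𝒪
  by_cases h : IsScalarPairClass 𝒪H
  · right
    refine ⟨h, fun h0 => hne ?_⟩
    rw [sjHTrichotomy_of h, h0, mul_zero]
  · left
    show r 𝒪H fH ≠ 0
    rwa [sjHTrichotomy_of_not h] at hne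

/-- **(xiii-0) body**: at a class with NON-semisimple image the trichotomy vanishes (no transfer target in the ANISOTROPIC `U(H)`, ★
`StableClassH.forall_not_transfersTo_of_not_isSemisimple` ⇒ `m_H = 0`; not `G`-regular ⇒ `r = 0` by `hr0`). [cite: Rogawski1990, Thm. 14.5.1 (a) p. 238; §14.5 p. 237] -/
theorem sjHTrichotomy_eq_zero_of_not_isSemisimple (hanis : ∀ x : Fin 3 → L, hermForm (cmConjRingHom L) H x x = 0 → x = 0)
    {𝒪H : StableClassH (cmConjRingHom L) (Matrix.of fun i j : Fin 2 => if i.val + j.val + 1 = 2 then (1 : L) else 0) (Matrix.of fun i j : Fin 1 => if i.val + j.val + 1 = 1 then (1 : L) else 0)} {fH : CompactlySupportedContinuousMap ((UnitaryGroup.cmDatum L 2 (Matrix.of fun i j : Fin 2 => if i.val + j.val + 1 = 2 then (1 : L) else 0)).Adelic × (UnitaryGroup.cmDatum L 1 (Matrix.of fun i j : Fin 1 => if i.val + j.val + 1 = 1 then (1 : L) else 0)).Adelic) ℂ} (hr0 : ¬ 𝒪H.IsGRegular endoForm_antidiagOne → r 𝒪H fH = 0)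
    (hns : ¬ (𝒪H.endoImage endoForm_antidiagOne).IsSemisimple) : sjHTrichotomy H α Cs r 𝒪H fH = 0 := by
  classical
  by_cases h : IsScalarPairClass 𝒪H
  · rw [sjHTrichotomy_of h]
    unfold scalarPairCoeff
    rw [dif_neg (fun ⟨𝒪, hT⟩ => StableClassH.forall_not_transfersTo_of_not_isSemisimple hanis hns 𝒪 hT), zero_mul]
  · rw [sjHTrichotomy_of_not h]
    refine hr0 fun hreg => hns ?_
    obtain ⟨a, rfl⟩ := stableClassHOf_surjective 𝒪H
    rw [StableClassH.endoImage_stableClassHOf]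
    exact StableClass.IsRegular.isSemisimple ((StableClass.isRegular_stableClassOf _).2 hreg)

/-- **(c-s) body [Lemma 14.5.2 (a)]**: at the `H`-regular class `[(h₂, a)]` (`charpoly h₂ = (X − a)(X − b)`, `a ≠ b`) the trichotomy vanishes (not a scalar pair,
not `G`-regular — repeated eigenvalue `a` — so `r = 0` by `hr0`). [cite: Rogawski1990, Lemma 14.5.2 (a) p. 238] -/
theorem sjHTrichotomy_eq_zero_of_charpoly_fst_eq {𝒪H : StableClassH (cmConjRingHom L) (Matrix.of fun i j : Fin 2 => if i.val + j.val + 1 = 2 then (1 : L) else 0) (Matrix.of fun i j : Fin 1 => if i.val + j.val + 1 = 1 then (1 : L) else 0)} {γH : (UnitaryGroup.cmDatum L 2 (Matrix.of fun i j : Fin 2 => if i.val + j.val + 1 = 2 then (1 : L) else 0)).Rational × (UnitaryGroup.cmDatum L 1 (Matrix.of fun i j : Fin 1 => if i.val + j.val + 1 = 1 then (1 : L) else 0)).Rational} {a b : L} {fH : CompactlySupportedContinuousMap ((UnitaryGroup.cmDatum L 2 (Matrix.of fun i j : Fin 2 => if i.val + j.val + 1 = 2 then (1 : L) else 0)).Adelic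 × (UnitaryGroup.cmDatum L 1 (Matrix.of fun i j : Fin 1 => if i.val + j.val + 1 = 1 then (1 : L) else 0)).Adelic) ℂ}
    (hr0 : ¬ 𝒪H.IsGRegular endoForm_antidiagOne → r 𝒪H fH = 0)
    (he : 𝒪H = stableClassHOf (cmConjRingHom L) (Matrix.of fun i j : Fin 2 => if i.val + j.val + 1 = 2 then (1 : L) else 0) (Matrix.of fun i j : Fin 1 => if i.val + j.val + 1 = 1 then (1 : L) else 0) γH) (hab : a ≠ b)
    (hchar : ((γH.1.val : GL (Fin 2) L) : Matrix (Fin 2) (Fin 2) L).charpoly = (Polynomial.X - Polynomial.C a) * (Polynomial.X - Polynomial.C b))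
    (h2 : ((γH.2.val : GL (Fin 1) L) : Matrix (Fin 1) (Fin 1) L) = a • (1 : Matrix (Fin 1) (Fin 1) L)) :
    sjHTrichotomy H α Cs r 𝒪H fH = 0 := by
  rw [sjHTrichotomy_of_not (not_isScalarPairClass_of_charpoly_fst_eq he hab hchar)]
  refine hr0 ?_
  rw [he]; refine not_isGRegular_stableClassHOf_of_not_separable' γH (not_separable_of_X_sub_C_sq_dvd' (a := a) ?_)
  have h2' : (((γH.2.val : GL (Fin 1) L) : Matrix (Fin 1) (Fin 1) L) 0 0) = a := by rw [h2]; simp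
  rw [hchar, h2']
  exact ⟨Polynomial.X - Polynomial.C b, by ring⟩

/-- **(xiii‴-cc) body [Prop. 10.1.2 (a); Lemma 14.5.2 (c)]**: at `γH = (ζ•1₂, u•1₁)` the trichotomy is SOME multiple of `f^H(γH ⊗ 1)` — `κ := m_H` if `u ≠ ζ`
(scalar pair, canonical representative `= γH`), `κ := 0` if `u = ζ` (central image, `r = 0` by `hr0`). [cite: Rogawski1990, Prop. 10.1.2 (a) p. 146; Lemma 14.5.2 (c) p. 238] -/
theorem exists_sjHTrichotomy_eq_mul_of_fst_eq_smul_one {𝒪H : StableClassH (cmConjRingHom L) (Matrix.of fun i j : Fin 2 => if i.val + j.val + 1 = 2 then (1 : L) else 0) (Matrix.of fun i j : Fin 1 => if i.val + j.val + 1 = 1 then (1 : L) else 0)} {γH : (UnitaryGroup.cmDatum L 2 (Matrix.of fun i j : Fin 2 => if i.val + j.val + 1 = 2 then (1 : L) else 0)).Rational × (UnitaryGroup.cmDatum L 1 (Matrix.of fun i j : Fin 1 => if i.val + j.val + 1 = 1 then (1 : L) else 0)).Rational} {ζ : L}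
    (hr0 : ∀ fH : CompactlySupportedContinuousMap ((UnitaryGroup.cmDatum L 2 (Matrix.of fun i j : Fin 2 => if i.val + j.val + 1 = 2 then (1 : L) else 0)).Adelic × (UnitaryGroup.cmDatum L 1 (Matrix.of fun i j : Fin 1 => if i.val + j.val + 1 = 1 then (1 : L) else 0)).Adelic) ℂ, ¬ 𝒪H.IsGRegular endoForm_antidiagOne → r 𝒪H fH = 0)
    (he : 𝒪H = stableClassHOf (cmConjRingHom L) (Matrix.of fun i j : Fin 2 => if i.val + j.val + 1 = 2 then (1 : L) else 0) (Matrix.of fun i j : Fin 1 => if i.val + j.val + 1 = 1 then (1 : L) else 0) γH)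
    (h1 : ((γH.1.val : GL (Fin 2) L) : Matrix (Fin 2) (Fin 2) L) = ζ • (1 : Matrix (Fin 2) (Fin 2) L)) :
    ∃ κ : ℂ, ∀ fH : CompactlySupportedContinuousMap ((UnitaryGroup.cmDatum L 2 (Matrix.of fun i j : Fin 2 => if i.val + j.val + 1 = 2 then (1 : L) else 0)).Adelic × (UnitaryGroup.cmDatum L 1 (Matrix.of fun i j : Fin 1 => if i.val + j.val + 1 = 1 then (1 : L) else 0)).Adelic) ℂ, sjHTrichotomy H α Cs r 𝒪H fH = κ * fH (((UnitaryGroup.cmDatum L 2 (Matrix.of fun i j : Fin 2 => if i.val + j.val + 1 = 2 then (1 : L) else 0)).toAdelic γH.1, (UnitaryGroup.cmDatum L 1 (Matrix.of fun i j : Fin 1 => if i.val + j.val + 1 = 1 then (1 : L) else 0)).toAdelic γH.2)) := by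
  have h2 := matrix_fin_one_eq_smul_one' ((γH.2.val : GL (Fin 1) L) : Matrix (Fin 1) (Fin 1) L)
  by_cases hu : ζ = ((γH.2.val : GL (Fin 1) L) : Matrix (Fin 1) (Fin 1) L) 0 0
  · refine ⟨0, fun fH => ?_⟩
    rw [zero_mul]
    have hns : ¬ IsScalarPairClass 𝒪H := fun h => by
      obtain ⟨-, ha, hb⟩ := h.rep_eq he h1 h2
      exact h.spec.1 (ha.trans (hu.trans hb.symm))
    rw [sjHTrichotomy_of_not hns]
    refine hr0 fH ?_
    rw [he]; refine not_isGRegular_stableClassHOf_of_not_separable' γH (not_separable_of_X_sub_C_sq_dvd' (a := ζ) ?_)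
    have h1' : (((γH.1.val : GL (Fin 2) L) : Matrix (Fin 2) (Fin 2) L).charpoly) = (Polynomial.X - Polynomial.C ζ) ^ 2 := by
      rw [h1, Matrix.smul_one_eq_diagonal, Matrix.charpoly_diagonal, Finset.prod_const, Finset.card_univ, Fintype.card_fin]
    rw [h1']
    exact Dvd.intro _ rfl
  · exact ⟨scalarPairCoeff H α Cs 𝒪H, fun fH => sjHTrichotomy_eq_coeff_mul he hu h1 h2 fH⟩

end Trichotomy

/-! ## §2 The `G`-regular datum and THE anchored `SJ_H` of ED 1.24 [Rogawski1990, Thm. 14.5.1 (a), (5.4.3)] -/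

section Anchored

variable {L : Type} [Field L] [NumberField L] [IsCMField L] (H : Matrix (Fin 3) (Fin 3) L)
  (α : StableClass (cmConjRingHom L) H → ℝ)
  (Cs : (UnitaryGroup.cmDatum L 3 H).Rational → L → L → (UnitaryGroup.cmDatum L 2 (Matrix.of fun i j : Fin 2 => if i.val + j.val + 1 = 2 then (1 : L) else 0)).Rational × (UnitaryGroup.cmDatum L 1 (Matrix.of fun i j : Fin 1 => if i.val + j.val + 1 = 1 then (1 : L) else 0)).Rational → ℝ)
  [∀ g : (UnitaryGroup.cmDatum L 2 (Matrix.of fun i j : Fin 2 => if i.val + j.val + 1 = 2 then (1 : L) else 0)).Adelic × (UnitaryGroup.cmDatum L 1 (Matrix.of fun i j : Fin 1 => if i.val + j.val + 1 = 1 then (1 : L) else 0)).Adelic,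
    MeasurableSpace (((UnitaryGroup.cmDatum L 2 (Matrix.of fun i j : Fin 2 => if i.val + j.val + 1 = 2 then (1 : L) else 0)).Adelic × (UnitaryGroup.cmDatum L 1 (Matrix.of fun i j : Fin 1 => if i.val + j.val + 1 = 1 then (1 : L) else 0)).Adelic) ⧸
      Subgroup.centralizer ({g} : Set ((UnitaryGroup.cmDatum L 2 (Matrix.of fun i j : Fin 2 => if i.val + j.val + 1 = 2 then (1 : L) else 0)).Adelic × (UnitaryGroup.cmDatum L 1 (Matrix.of fun i j : Fin 1 => if i.val + j.val + 1 = 1 then (1 : L) else 0)).Adelic)))]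
  (κH : StableClassH (cmConjRingHom L) (Matrix.of fun i j : Fin 2 => if i.val + j.val + 1 = 2 then (1 : L) else 0) (Matrix.of fun i j : Fin 1 => if i.val + j.val + 1 = 1 then (1 : L) else 0) → ℝ) (m₂ : OrbitalMeasureFamily ((UnitaryGroup.cmDatum L 2 (Matrix.of fun i j : Fin 2 => if i.val + j.val + 1 = 2 then (1 : L) else 0)).Adelic × (UnitaryGroup.cmDatum L 1 (Matrix.of fun i j : Fin 1 => if i.val + j.val + 1 = 1 then (1 : L) else 0)).Adelic))

open scoped Classical in
/-- **THE `G`-REGULAR `SJ_H` DATUM**: `κ_H(𝒪H) · Φ^{st,𝐀}_H(out 𝒪H; m₂; f^H)` (★ `adelicStableOrbitalIntegralH` at the chosen representative, any representative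
gives the same value) at a `G`-regular stable class, `0` elsewhere — ED ≤ 1.24a₀'s anchored `sjH`, kit-free. [cite: Rogawski1990, Thm. 14.5.1 (a) p. 238; §5.4 (5.4.3) pp. 72–73] -/
def regularSJH (𝒪H : StableClassH (cmConjRingHom L) (Matrix.of fun i j : Fin 2 => if i.val + j.val + 1 = 2 then (1 : L) else 0) (Matrix.of fun i j : Fin 1 => if i.val + j.val + 1 = 1 then (1 : L) else 0)) (fH : CompactlySupportedContinuousMap ((UnitaryGroup.cmDatum L 2 (Matrix.of fun i j : Fin 2 => if i.val + j.val + 1 = 2 then (1 : L) else 0)).Adelic × (UnitaryGroup.cmDatum L 1 (Matrix.of fun i j : Fin 1 => if i.val + j.val + 1 = 1 then (1 : L) else 0)).Adelic) ℂ) : ℂ :=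
  if 𝒪H.IsGRegular endoForm_antidiagOne then ((κH 𝒪H : ℝ) : ℂ) * adelicStableOrbitalIntegralH L (Quotient.out 𝒪H) m₂ ⇑fH else 0

/-- **THE ANCHORED `SJ_H` OF ED 1.24** (O7 trichotomy): scalar-pair classes ↦ `m_H · f^H(γH♮ ⊗ 1)`; `G`-regular classes ↦ `κ_H · Φ^{st,𝐀}_H`; every other
class ↦ `0`. [cite: Rogawski1990, Thm. 14.5.1 (a) p. 238; Lemma 14.5.2 (b) p. 238; Prop. 10.1.2 (a) p. 146] -/
def anchoredSJH : StableClassH (cmConjRingHom L) (Matrix.of fun i j : Fin 2 => if i.val + j.val + 1 = 2 then (1 : L) else 0) (Matrix.of fun i j : Fin 1 => if i.val + j.val + 1 = 1 then (1 : L) else 0) → CompactlySupportedContinuousMap ((UnitaryGroup.cmDatum L 2 (Matrix.of fun i j : Fin 2 => if i.val + j.val + 1 = 2 then (1 : L) else 0)).Adelic × (UnitaryGroup.cmDatum L 1 (Matrix.of fun i j : Fin 1 => if i.val + j.val + 1 = 1 then (1 : L) else 0)).Adelic) ℂ → ℂ :=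
  sjHTrichotomy H α Cs (regularSJH κH m₂)

variable {H α Cs κH m₂}

/-- Off the `G`-regular classes the regular datum is `0`. [cite: Rogawski1990, Thm. 14.5.1 (a) p. 238] -/
theorem regularSJH_eq_zero_of_not_isGRegular {𝒪H : StableClassH (cmConjRingHom L) (Matrix.of fun i j : Fin 2 => if i.val + j.val + 1 = 2 then (1 : L) else 0) (Matrix.of fun i j : Fin 1 => if i.val + j.val + 1 = 1 then (1 : L) else 0)} (h : ¬ 𝒪H.IsGRegular endoForm_antidiagOne)
    (fH : CompactlySupportedContinuousMap ((UnitaryGroup.cmDatum L 2 (Matrix.of fun i j : Fin 2 => if i.val + j.val + 1 = 2 then (1 : L) else 0)).Adelic × (UnitaryGroup.cmDatum L 1 (Matrix.of fun i j : Fin 1 => if i.val + j.val + 1 = 1 then (1 : L) else 0)).Adelic) ℂ) : regularSJH κH m₂ 𝒪H fH = 0 := by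
  unfold regularSJH; rw [if_neg h]

/-- **(xiii″) body for the regular datum**: at a `G`-regular `𝒪H = 𝒪′_st(γH)` the value is `κ_H(𝒪H) · Φ^{st,𝐀}_H(γH; m₂; f^H)` for THIS `γH` (★
`adelicStableOrbitalIntegralH_out_eq`). [cite: Rogawski1990, Thm. 14.5.1 (a) p. 238; §5.4 Prop. 5.4.1 p. 72] -/
theorem regularSJH_eq_of_isGRegular {𝒪H : StableClassH (cmConjRingHom L) (Matrix.of fun i j : Fin 2 => if i.val + j.val + 1 = 2 then (1 : L) else 0) (Matrix.of fun i j : Fin 1 => if i.val + j.val + 1 = 1 then (1 : L) else 0)} {γH : (UnitaryGroup.cmDatum L 2 (Matrix.of fun i j : Fin 2 => if i.val + j.val + 1 = 2 then (1 : L) else 0)).Rational × (UnitaryGroup.cmDatum L 1 (Matrix.of fun i j : Fin 1 => if i.val + j.val + 1 = 1 then (1 : L) else 0)).Rational} (he : 𝒪H = stableClassHOf (cmConjRingHom L) (Matrix.of fun i j : Fin 2 => if i.val + j.val + 1 = 2 then (1 : L) else 0) (Matrix.of fun i j : Fin 1 => if i.val + j.val + 1 = 1 then (1 : L) else 0) 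γH)
    (hreg : IsGRegular (cmConjRingHom L) (Matrix.of fun i j : Fin 2 => if i.val + j.val + 1 = 2 then (1 : L) else 0) (Matrix.of fun i j : Fin 1 => if i.val + j.val + 1 = 1 then (1 : L) else 0) (Matrix.of fun i j : Fin 3 => if i.val + j.val + 1 = 3 then (1 : L) else 0) endoForm_antidiagOne γH) (fH : CompactlySupportedContinuousMap ((UnitaryGroup.cmDatum L 2 (Matrix.of fun i j : Fin 2 => if i.val + j.val + 1 = 2 then (1 : L) else 0)).Adelic × (UnitaryGroup.cmDatum L 1 (Matrix.of fun i j : Fin 1 => if i.val + j.val + 1 = 1 then (1 : L) else 0)).Adelic) ℂ) :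
    regularSJH κH m₂ 𝒪H fH = ((κH 𝒪H : ℝ) : ℂ) * adelicStableOrbitalIntegralH L γH m₂ ⇑fH := by
  have hR : 𝒪H.IsGRegular endoForm_antidiagOne := StableClassH.isGRegular_of_eq_stableClassHOf he hreg
  unfold regularSJH
  rw [if_pos hR]
  congr 1
  exact adelicStableOrbitalIntegralH_out_eq he.symm _ _

/-- **(xiii-f) body for the regular datum** (★ `finite_support_ite_isGRegular_mul_adelicStableOrbitalIntegralH_out`). [cite: Rogawski1990, §14.5 p. 238] -/
theorem finite_support_regularSJH (fH : CompactlySupportedContinuousMap ((UnitaryGroup.cmDatum L 2 (Matrix.of fun i j : Fin 2 => if i.val + j.val + 1 = 2 then (1 : L) else 0)).Adelic × (UnitaryGroup.cmDatum L 1 (Matrix.of fun i j : Fin 1 => if i.val + j.val + 1 = 1 then (1 : L) else 0)).Adelic) ℂ) : (Function.support fun 𝒪H => regularSJH κH m₂ 𝒪H fH).Finite := by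
  classical
  exact finite_support_ite_isGRegular_mul_adelicStableOrbitalIntegralH_out (L := L) (fun 𝒪H => ((κH 𝒪H : ℝ) : ℂ)) m₂ fH

/-- **pin (xiii″) body**: at a `G`-regular `𝒪H = 𝒪′_st(γH)` (not a scalar pair, ★ `IsScalarPairClass.not_isGRegular`) the anchored `SJ_H` is
`κ_H(𝒪H) · Φ^{st,𝐀}_H(γH; m₂; f^H)`. [cite: Rogawski1990, Thm. 14.5.1 (a) p. 238; §5.4 Prop. 5.4.1 p. 72] -/
theorem anchoredSJH_eq_of_isGRegular {𝒪H : StableClassH (cmConjRingHom L) (Matrix.of fun i j : Fin 2 => if i.val + j.val + 1 = 2 then (1 : L) else 0) (Matrix.of fun i j : Fin 1 => if i.val + j.val + 1 = 1 then (1 : L) else 0)} {γH : (UnitaryGroup.cmDatum L 2 (Matrix.of fun i j : Fin 2 => if i.val + j.val + 1 = 2 then (1 : L) else 0)).Rational × (UnitaryGroup.cmDatum L 1 (Matrix.of fun i j : Fin 1 => if i.val + j.val + 1 = 1 then (1 : L) else 0)).Rational} (he : 𝒪H = stableClassHOf (cmConjRingHom L) (Matrix.of fun i j : Fin 2 =>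 if i.val + j.val + 1 = 2 then (1 : L) else 0) (Matrix.of fun i j : Fin 1 => if i.val + j.val + 1 = 1 then (1 : L) else 0) γH)
    (hreg : IsGRegular (cmConjRingHom L) (Matrix.of fun i j : Fin 2 => if i.val + j.val + 1 = 2 then (1 : L) else 0) (Matrix.of fun i j : Fin 1 => if i.val + j.val + 1 = 1 then (1 : L) else 0) (Matrix.of fun i j : Fin 3 => if i.val + j.val + 1 = 3 then (1 : L) else 0) endoForm_antidiagOne γH) (fH : CompactlySupportedContinuousMap ((UnitaryGroup.cmDatum L 2 (Matrix.of fun i j : Fin 2 => if i.val + j.val + 1 = 2 then (1 : L) else 0)).Adelic × (UnitaryGroup.cmDatum L 1 (Matrix.of fun i j : Fin 1 => if i.val + j.val + 1 = 1 then (1 : L) else 0)).Adelic) ℂ) :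
    anchoredSJH H α Cs κH m₂ 𝒪H fH = ((κH 𝒪H : ℝ) : ℂ) * adelicStableOrbitalIntegralH L γH m₂ ⇑fH := by
  have hns : ¬ IsScalarPairClass 𝒪H := fun h => h.not_isGRegular (StableClassH.isGRegular_of_eq_stableClassHOf he hreg)
  unfold anchoredSJH
  rw [sjHTrichotomy_of_not hns]
  exact regularSJH_eq_of_isGRegular he hreg fH

/-- **pin (xiii-f) body**: finite support of `𝒪H ↦ SJ_H(𝒪H, f^H)`. [cite: Rogawski1990, §14.5 p. 238; §5.4 pp. 72–73] -/
theorem finite_support_anchoredSJH (fH : CompactlySupportedContinuousMap ((UnitaryGroup.cmDatum L 2 (Matrix.of fun i j : Fin 2 => if i.val + j.val + 1 = 2 then (1 : L) else 0)).Adelic × (UnitaryGroup.cmDatum L 1 (Matrix.of fun i j : Fin 1 => if i.val + j.val + 1 = 1 then (1 : L) else 0)).Adelic) ℂ) :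
    (Function.support fun 𝒪H => anchoredSJH H α Cs κH m₂ 𝒪H fH).Finite :=
  finite_support_sjHTrichotomy fH (finite_support_regularSJH fH)

/-- **pin (xiii-0) body**: `SJ_H` vanishes at the classes with non-semisimple image (`U(H)` anisotropic). [cite: Rogawski1990, Thm. 14.5.1 (a) p. 238; §14.5 p. 237] -/
theorem anchoredSJH_eq_zero_of_not_isSemisimple (hanis : ∀ x : Fin 3 → L, hermForm (cmConjRingHom L) H x x = 0 → x = 0)
    {𝒪H : StableClassH (cmConjRingHom L) (Matrix.of fun i j : Fin 2 => if i.val + j.val + 1 = 2 then (1 : L) else 0) (Matrix.of fun i j : Fin 1 => if i.val + j.val + 1 = 1 then (1 : L) else 0)} (hns : ¬ (𝒪H.endoImage endoForm_antidiagOne).IsSemisimple) (fH : CompactlySupportedContinuousMap ((UnitaryGroup.cmDatum L 2 (Matrix.of fun i j : Fin 2 => if i.val + j.val + 1 = 2 then (1 : L) else 0)).Adelic × (UnitaryGroup.cmDatum L 1 (Matrix.of fun i j : Fin 1 => if i.val + j.val + 1 = 1 then (1 : L) else 0)).Adelic) ℂ) :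
    anchoredSJH H α Cs κH m₂ 𝒪H fH = 0 :=
  sjHTrichotomy_eq_zero_of_not_isSemisimple hanis (fun h => regularSJH_eq_zero_of_not_isGRegular h fH) hns

/-- **pin (c-s) body [Lemma 14.5.2 (a)]**: `SJ_H` vanishes at the `H`-regular class `[(h₂, a)]`, `charpoly h₂ = (X − a)(X − b)`, `a ≠ b`.
[cite: Rogawski1990, Lemma 14.5.2 (a) p. 238] -/
theorem anchoredSJH_eq_zero_of_charpoly_fst_eq {𝒪H : StableClassH (cmConjRingHom L) (Matrix.of fun i j : Fin 2 => if i.val + j.val + 1 = 2 then (1 : L) else 0) (Matrix.of fun i j : Fin 1 => if i.val + j.val + 1 = 1 then (1 : L) else 0)} {γH : (UnitaryGroup.cmDatum L 2 (Matrix.of fun i j : Fin 2 => if i.val + j.val + 1 = 2 then (1 : L) else 0)).Rational × (UnitaryGroup.cmDatum L 1 (Matrix.of fun i j : Fin 1 => if i.val + j.val + 1 = 1 then (1 : L) else 0)).Rational} {a b : L}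
    (he : 𝒪H = stableClassHOf (cmConjRingHom L) (Matrix.of fun i j : Fin 2 => if i.val + j.val + 1 = 2 then (1 : L) else 0) (Matrix.of fun i j : Fin 1 => if i.val + j.val + 1 = 1 then (1 : L) else 0) γH) (hab : a ≠ b)
    (hchar : ((γH.1.val : GL (Fin 2) L) : Matrix (Fin 2) (Fin 2) L).charpoly = (Polynomial.X - Polynomial.C a) * (Polynomial.X - Polynomial.C b))
    (h2 : ((γH.2.val : GL (Fin 1) L) : Matrix (Fin 1) (Fin 1) L) = a • (1 : Matrix (Fin 1) (Fin 1) L)) (fH : CompactlySupportedContinuousMap ((UnitaryGroup.cmDatum L 2 (Matrix.of fun i j : Fin 2 => if i.val + j.val + 1 = 2 then (1 : L) else 0)).Adelic × (UnitaryGroup.cmDatum L 1 (Matrix.of fun i j : Fin 1 => if i.val + j.val + 1 = 1 then (1 : L) else 0)).Adelic) ℂ) :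
    anchoredSJH H α Cs κH m₂ 𝒪H fH = 0 :=
  sjHTrichotomy_eq_zero_of_charpoly_fst_eq (fun h => regularSJH_eq_zero_of_not_isGRegular h fH) he hab hchar h2

/-- **pin (xiii‴-cc) body**: at `γH = (ζ•1₂, h₁)` the anchored `SJ_H` is SOME multiple of `f^H(γH ⊗ 1)`. [cite: Rogawski1990, Prop. 10.1.2 (a) p. 146; Lemma 14.5.2 (c) p. 238] -/
theorem exists_anchoredSJH_eq_mul_of_fst_eq_smul_one {𝒪H : StableClassH (cmConjRingHom L) (Matrix.of fun i j : Fin 2 => if i.val + j.val + 1 = 2 then (1 : L) else 0) (Matrix.of fun i j : Fin 1 => if i.val + j.val + 1 = 1 then (1 : L) else 0)} {γH : (UnitaryGroup.cmDatum L 2 (Matrix.of fun i j : Fin 2 => if i.val + j.val + 1 = 2 then (1 : L) else 0)).Rational × (UnitaryGroup.cmDatum L 1 (Matrix.of fun i j : Fin 1 => if i.val + j.val + 1 = 1 then (1 : L) else 0)).Rational} {ζ : L}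
    (he : 𝒪H = stableClassHOf (cmConjRingHom L) (Matrix.of fun i j : Fin 2 => if i.val + j.val + 1 = 2 then (1 : L) else 0) (Matrix.of fun i j : Fin 1 => if i.val + j.val + 1 = 1 then (1 : L) else 0) γH)
    (h1 : ((γH.1.val : GL (Fin 2) L) : Matrix (Fin 2) (Fin 2) L) = ζ • (1 : Matrix (Fin 2) (Fin 2) L)) :
    ∃ κ : ℂ, ∀ fH : CompactlySupportedContinuousMap ((UnitaryGroup.cmDatum L 2 (Matrix.of fun i j : Fin 2 => if i.val + j.val + 1 = 2 then (1 : L) else 0)).Adelic × (UnitaryGroup.cmDatum L 1 (Matrix.of fun i j : Fin 1 => if i.val + j.val + 1 = 1 then (1 : L) else 0)).Adelic) ℂ, anchoredSJH H α Cs κH m₂ 𝒪H fH = κ * fH (((UnitaryGroup.cmDatum L 2 (Matrix.of fun i j : Fin 2 => if i.val + j.val + 1 = 2 then (1 : L) else 0)).toAdelic γH.1, (UnitaryGroup.cmDatum L 1 (Matrix.of fun i j : Fin 1 => if i.val + j.val + 1 = 1 then (1 : L) else 0)).toAdelic γH.2)) :=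
  exists_sjHTrichotomy_eq_mul_of_fst_eq_smul_one (fun fH h => regularSJH_eq_zero_of_not_isGRegular h fH) he h1

/-- **pin (xiii″-s∕κ)(i) body [Lemma 14.5.2 (b); Prop. 10.1.2 (a)]**: at `𝒪H = 𝒪′_st(a•1₂, b•1₁) ↦ 𝒪`, `a ≠ b`, the anchored `SJ_H(𝒪H, f^H)` is
`m_H · f^H(γH ⊗ 1)` with `m_H = α(𝒪) · Cs (out 𝒪) a b γH`. [cite: Rogawski1990, Prop. 10.1.2 (a) p. 146; Lemma 14.5.2 (b) p. 238] -/
theorem anchoredSJH_eq_of_transfersTo {𝒪H : StableClassH (cmConjRingHom L) (Matrix.of fun i j : Fin 2 => if i.val + j.val + 1 = 2 then (1 : L) else 0) (Matrix.of fun i j : Fin 1 => if i.val + j.val + 1 = 1 then (1 : L) else 0)} {𝒪 : StableClass (cmConjRingHom L) H} {γH : (UnitaryGroup.cmDatum L 2 (Matrix.of fun i j : Fin 2 => if i.val + j.val + 1 = 2 then (1 : L) else 0)).Rational × (UnitaryGroup.cmDatum L 1 (Matrix.of fun i j : Fin 1 => if i.val + j.val + 1 = 1 then (1 : L) else 0)).Rational}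 {a b : L}
    (he : 𝒪H = stableClassHOf (cmConjRingHom L) (Matrix.of fun i j : Fin 2 => if i.val + j.val + 1 = 2 then (1 : L) else 0) (Matrix.of fun i j : Fin 1 => if i.val + j.val + 1 = 1 then (1 : L) else 0) γH) (hab : a ≠ b)
    (h1 : ((γH.1.val : GL (Fin 2) L) : Matrix (Fin 2) (Fin 2) L) = a • (1 : Matrix (Fin 2) (Fin 2) L))
    (h2 : ((γH.2.val : GL (Fin 1) L) : Matrix (Fin 1) (Fin 1) L) = b • (1 : Matrix (Fin 1) (Fin 1) L))
    (hT : 𝒪H.TransfersTo H endoForm_antidiagOne 𝒪) (fH : CompactlySupportedContinuousMap ((UnitaryGroup.cmDatum L 2 (Matrix.of fun i j : Fin 2 => if i.val + j.val + 1 = 2 then (1 : L) else 0)).Adelic × (UnitaryGroup.cmDatum L 1 (Matrix.of fun i j : Fin 1 => if i.val + j.val + 1 = 1 then (1 : L) else 0)).Adelic) ℂ) :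
    anchoredSJH H α Cs κH m₂ 𝒪H fH = ((α 𝒪 * Cs (Quotient.out (s := stableConjSetoid _ _) 𝒪) a b γH : ℝ) : ℂ) * fH (((UnitaryGroup.cmDatum L 2 (Matrix.of fun i j : Fin 2 => if i.val + j.val + 1 = 2 then (1 : L) else 0)).toAdelic γH.1, (UnitaryGroup.cmDatum L 1 (Matrix.of fun i j : Fin 1 => if i.val + j.val + 1 = 1 then (1 : L) else 0)).toAdelic γH.2)) :=
  sjHTrichotomy_eq_of_transfersTo he hab h1 h2 hT fH

end Anchored


end Literature.NumberTheory.Rogawski1990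

end
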